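import Summits.CriticalPhenomena.PercolationContinuityZ3.Theorems.Transplant.SkelPhiCorridorStepsFC
import Summits.CriticalPhenomena.PercolationContinuityZ3.Theorems.Transplant.SkelPhiCorridorKitsFCQ
import HarnessLib
/-!
# WAVE-Q binder row «SkelPhiCorridorStepsFC» ↦ «SkelPhiCorridorStepsFCQ» (quasi-step rung (N3-b); captain gen-1 g4, WAVE-Q-BINDER-rows v0.7/v0.8, row Q45, FLOOR row; family stmt-g33 = «SkelPhiCorridor*» / «SkelPhiFace*»):
# **THE FORCED-KIT CLAUSES OF EVERY STEP OF A SCHEDULE WITH PARKING, ONE x-FRAME (plain window), UNDER EXACT-FOOTPRINT QUASI-STEPS** — `Skelφ.hkits_schedFCQ`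

builds on p205010 (kernel theorem, internal audit signed; external expert review pending) — nothing in this file uses p205010; nothing here is a claim about any open node (the
quasi-step node's statement, name and wording are a lead's).  Lane `prim-bschramm`, seat `prim-bschramm-stmt` gen 33 (port pen).  Helper file (`--supports stmt-CriticalPhenomena-4575 --as helper`);
def-free.  PORT RULES (captain #6109/#6122 hunk classes + R-1 = L-hp8-1 (b)): twin of the one `hstep`-threading declaration of the tree module «SkelPhiCorridorStepsFC» (sha256 cfb7f8b967e1d2a8…,
imported), statement and proof BYTE-IDENTICAL except: (i) `(hstep : Steps G φ) ↦ {M : ℕ} (hqφ : Skelφ.QStepsN G φ M)` with the frame-cost floor `hPN : M·(kq+3) ≤ P.N`;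
(ii) `hkits_levelFC ↦ hkits_levelFCQ` («SkelPhiCorridorKitsFCQ» Q38); (iv) FLOOR tokens (p5-g28's pull list): `KCmax ↦ P.N·KCmax` in `hT`, `hr₀`, `hrs`, `hreach`, `hE` (and
`level_widthsNP … (KCmax := P.N·KCmax)`), `KCmax + 1 ↦ (KCmax+1)·(P.N+2)` in `hcS`.  Regression: `M = 1`, `P.N`-tokens at `qStepsN_of_steps` give the original.  Docstrings and
citations are the original's.
-/

noncomputable section

open scoped Classical

namespace Summit.CriticalPhenomena.PercolationContinuityZ3.Theorems.Transplant

namespace Skelφ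

open MeasureTheory
open Literature.Probability.Percolation Literature.Probability.LatticeModels SimpleGraph KNLevels
open Literature.Barriers.CriticalPhenomena (graphBall graphBall_finite mem_graphBall_self graphBall_mono)
open Skel (winGraph winGraph_adj winGraph_le winGraphIn winGraphIn_le KitGeom)
open Literature.Probability.Percolation.KozmaNitzan.Cells (oth oth_ne eq_oth_of_ne oth_oth)
open SkelI (tanOff tanTgt tanTgt_mem)
open ChainPlanar ChainPara

variable {V : Type} [DecidableEq V] {G : SimpleGraph V} [G.LocallyFinite] {φ : V → Site 2}

/-! ## The clauses of every step, plain window, kit at the column end -/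

/-- **THE FORCED-KIT CLAUSES OF EVERY STEP OF A SCHEDULE WITH PARKING, ONE x-FRAME, PLAIN WINDOW** — the `hkits` of
`WinChainData.chainF_of_seg` at `planarWindowWin (lip_runX …) w₀ R` / `S.toFrame`: from the kit rows, the slot rows `tanOff ≤ j₀`, `j₁ ≤ R′`,
`j₁ + reach ≤ R′`, the rim cover `hcover`, the count rows, and the per-step per-centre PARKED-OR-ROUTED input `hrouteS` (under the law `W'`).
[cite: KozmaNitzan2024, §4 Lemma 10 (pp. 17–22), Lemma 12 (pp. 23–25)] [this work] -/
theorem hkits_schedFCQ [Countable V] (hlipφ : Lip G φ) {M : ℕ} (hqφ : QStepsN G φ M) {Δ : ℕ} (hΔ : ∀ v, G.degree v ≤ Δ) {q : unitInterval} {δ : ℝ}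
    (hδ : 0 < δ)
    -- the frame, the schedule, the window
    {nL : ℕ} (hnL : 1 ≤ nL) (c₀ : V) (hL : ℤ) {σ : ℤ} (hσ : σ = 1 ∨ σ = -1) {kq : ℕ} (hκL : hL.natAbs ≤ kq * nL)
    (S : ScheduleNP) {w₀ : V} {R r : ℕ}
    -- kit constants
    (P : ApronPrm) {Mz Rs KCmax rs cS cU : ℕ} (hPN : M * (kq + 3) ≤ P.N) (hA : P.A = (Mz + 1 : ℕ) * (shearUnit nL hL : ℤ) + 1)
    (hdD : P.d + 2 ≤ shellD P) (hDρ : Rs + 1 ≤ shellD P) (hKCmax : (shellD P + Mz + 1) * (kq + 1) ≤ KCmax)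
    (hT : (shellD P : ℤ) + P.N * KCmax + Rs ≤ tanOff P.ℓs P.M)
    (hr₀ : P.N * (tanOff P.ℓs P.M + 2) + P.N * P.d + (P.N * KCmax + Rs) ≤ P.r₀) (hR : P.r₀ ≤ R)
    (hrs : 1 + (P.N * (tanOff P.ℓs P.M + 2) + P.N * P.d + (P.N * KCmax + Rs)) ≤ rs)
    (hcS : (P.N + 1) * (tanOff P.ℓs P.M + 1) + (P.N + 1) * P.d + (KCmax + 1) * (P.N + 2) + cU ≤ cS)
    (hreach : r + (P.N * (tanOff P.ℓs P.M + 1) + P.N * P.d + P.N * KCmax) ≤ P.r₀)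
    -- the short region and the zone datum
    (Rg : V → Finset V) (hRg : ∀ c, ∀ u ∈ Rg c, u ∈ graphBall G c Rs) (hRgcard : ∀ c, (Rg c).card ≤ cU) (hcU1 : 1 ≤ cU)
    (Λc : V → ℕ → Finset V) (kz : ℕ) (hΛRg : ∀ c, Λc c kz ⊆ Rg c) (hzconn : ∀ c, ∀ s ∈ Λc c kz, PathIn G (↑(Λc c kz) : Set V) c s)
    (hcz : ∀ c, c ∈ Λc c kz)
    -- the chain data and its slot rows
    (Pd : WinChainData V) (hj0 : tanOff P.ℓs P.M ≤ Pd.j₀) (hj1R : Pd.j₁ ≤ S.R')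
    (hE : Pd.j₁ + (P.N * (tanOff P.ℓs P.M + 1) + P.N * P.d + P.N * KCmax) ≤ S.R')
    (kk : ℕ) (hN : kk * (Δ + 1) ^ (2 * rs) ≤ Pd.N) (hk : (1 - (q : ℝ) ^ (1 + Δ * cS + cS * cU)) ^ kk ≤ δ)
    -- the rim of every region window is covered by `Rim`
    (hcover : ∀ k ≤ S.N, ∀ v ∈ Win G (runX φ c₀ nL hL σ) w₀ (S.region k) R, v ∉ graphBall G w₀ (R - P.r₀) → v ∈ Pd.Rim k)
    -- THE PER-STEP PER-CENTRE INPUT (under the law `W'`; built by the caller from a sub-box law on the region windows)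
    {W' : Sym2 V → unitInterval}
    (hrouteS : ∀ k ≤ S.N, ∀ c : V,
      runX φ c₀ nL hL σ c ∈ Finset.Icc (S.lo k - ((S.R' : ℕ) : Site 2)) (S.hi k + ((S.R' : ℕ) : Site 2)) → c ∈ graphBall G w₀ (R - r) →
      c ∈ Win G (runX φ c₀ nL hL σ) w₀ (ScheduleNP.core S (k + 1)) R ∪ Pd.Rim k ∨
      ∃ Qt Ft : Finset V, Ft ⊆ Win G (runX φ c₀ nL hL σ) w₀ (ScheduleNP.core S (k + 1)) R ∪ Pd.Rim k ∧
        Qt ⊆ Win G (runX φ c₀ nL hL σ) w₀ (S.region k) R ∧ 1 - δ ^ 3 ≤ (prodBernoulli W').real (linkIn (↑Qt : Set V) (Λc c kz) Ft)) :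
    ∀ k ≤ S.N, ∀ j ∈ Finset.Icc Pd.j₀ Pd.j₁, ∃ (σ' : SData V) (Sz : Finset V),
      SHyp (Pd.stepLF (planarWindowWin (lip_runX hlipφ hσ hnL c₀ hL) w₀ R) S.toFrame k) j σ' ∧ σ'.N ≤ Pd.N ∧
      (1 - (q : ℝ) ^ σ'.sB) ^ σ'.k ≤ δ ∧ Sz ⊆ (planarWindowWin (lip_runX hlipφ hσ hnL c₀ hL) w₀ R).stepDF S.toFrame k ∧
      (∀ x ∈ σ'.K, σ'.face x ⊆ Sz) ∧
      RelayClause (Pd.stepLF (planarWindowWin (lip_runX hlipφ hσ hnL c₀ hL) w₀ R) S.toFrame k) W' j σ' Sz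
        (Pd.coreEF (planarWindowWin (lip_runX hlipφ hσ hnL c₀ hL) w₀ R) S.toFrame k)
        ((planarWindowWin (lip_runX hlipφ hσ hnL c₀ hL) w₀ R).stepDF S.toFrame k) δ := by
  intro k hkN j hj
  set ψ := runX φ c₀ nL hL σ with hψ
  obtain ⟨hj₀, hj₁⟩ := Finset.mem_Icc.1 hj
  have hjR : j ≤ S.R' := hj₁.trans hj1R
  -- the planar level box lies in the region
  have hlev : Finset.Icc (S.lo k - ((j : ℕ) : Site 2)) (S.hi k + ((j : ℕ) : Site 2)) ⊆ S.region k := S.level_subset_region hkN hjR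
  have hXD : winLevel G ψ w₀ R (S.lo k) (S.hi k) j ⊆ Win G ψ w₀ (S.region k) R := Win_mono G _ hlev le_rfl
  -- the rim: far level vertices are covered
  have hfarT : ∀ v ∈ winLevel G ψ w₀ R (S.lo k) (S.hi k) j, v ∉ graphBall G w₀ (R - P.r₀) →
      v ∈ Win G ψ w₀ (ScheduleNP.core S (k + 1)) R ∪ Pd.Rim k := fun v hv hfar =>
    Finset.mem_union_right _ (hcover k hkN v (hXD hv) hfar)
  -- the level widths and the reach row
  obtain ⟨hwide, hdw, hDw⟩ := level_widthsNP S (k := k) (by omega) P (KCmax := P.N * KCmax) (Rs := Rs) (j := j) (hj0.trans hj₀) hdD hT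
  have hEj : j + (P.N * (tanOff P.ℓs P.M + 1) + P.N * P.d + P.N * KCmax) ≤ S.R' := by omega
  -- the clause of the level, from the per-centre input
  rw [stepLF_toFrame_win_eq, stepDF_toFrame_win_eq, coreEF_toFrame_win_eq]
  exact hkits_levelFCQ hlipφ hqφ hΔ hδ hnL c₀ hL hσ hκL P hPN hA hdD hDρ hKCmax hwide hdw hDw hT hr₀ hR hrs hcS hEj hreach
    Rg hRg hRgcard hcU1 Λc kz hΛRg hzconn hcz kk Pd.o Pd.Sfin hXD hfarT hN hk (hrouteS k hkN)

end Skelφ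

end Summit.CriticalPhenomena.PercolationContinuityZ3.Theorems.Transplant

end
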